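import Literature.NumberTheory.Transcendental.RationalSubspaces
import Literature.NumberTheory.Transcendental.PhilipponZeroEstimateStd
import Literature.NumberTheory.Transcendental.SemistableQuotients
import HarnessLib

/-!
# Index descent: semistability controls the obstruction subgroups over `ℂ`

Topic: `Literature/NumberTheory/Transcendental`. Plan item W4 (closing argument, GAP #1) of the
unit `provefact-Literature.NumberTheory.Transcendental.H-b596640137`. Semistability of
`𝔟 ⊆ Lie M_κ` (`GaGmE.Std.Semistable`, `SemistableQuotients.lean`) is the index inequality
`dim 𝔟 · (n - dim 𝔨) ≤ (dim 𝔟 - dim(𝔟 ∩ 𝔨)) · n` for the Lie algebras `𝔨` of the connected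
algebraic subgroups given by data `(A, C, Ξ)` with `Ξ` over `ℚ̄` (`GaGmE.SubgroupData`), whereas
Philippon's zero estimate (`PhilipponZeroEstimateStd.philippon1986_std`) produces data with `Ξ`
over `ℂ` (`GaGmE.Std.SubgroupDataC`). PROVED here: for a `ℚ̄`-rational `𝔟`, semistability
implies the index inequality for EVERY `ℂ`-datum `K ≠ M_κ`
(`GaGmE.Std.Semistable.index_le`): replace `Ξ` by a `ℚ̄`-rational `Ξ'` of the same dimension
with `dim(𝔟 ∩ Lie') ≥ dim(𝔟 ∩ Lie)` — elementary linear algebra of `ℚ̄`-rational subspaces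
(`RationalSubspaces.lean`): with `Θ = Ξ^⊥ ⊇ Z = W₀^⊥` (`W₀` the compatibility space) and
`U` the `s`-projection of `𝔟 ∩ Lie(A, C)`, take `Θ' ⊇ Z + U₁` rational of dimension `dim Θ`,
`U₁ ⊇ Z ∩ U` rational of dimension `dim(U ∩ Θ)` inside `U`, and `Ξ' = Θ'^⊥`.

## References

* A. Baker, G. Wüstholz, *Logarithmic Forms and Diophantine Geometry*, CUP 2007, §6.1–6.2, §6.7.
* P. Philippon, *Lemmes de zéros dans les groupes algébriques commutatifs*, Bull. SMF 114 (1986).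
-/

noncomputable section

open Module Submodule

namespace Literature.NumberTheory.Transcendental

namespace LiePresentation

variable (K : Type*) {L : Type*} [Field K] [Field L] [Algebra K L] {σ : Type*} [Fintype σ]

/-! ### More on annihilators and rational subspaces -/

omit [Fintype σ] in
/-- The empty system has the whole space as solutions. [folklore] -/
theorem solSpace_empty [Fintype σ] : solSpace K (L := L) (σ := σ) ∅ = ⊤ := by
  ext v; simp [mem_solSpace]

/-- The whole space is `K`-rational. [folklore] -/
theorem isKRational_top : IsKRational K (⊤ : Submodule L (σ → L)) := by
  rw [← solSpace_empty K]; exact isKRational_solSpace K _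

/-- `dotAnn` is antitone. [folklore] -/
theorem dotAnn_anti {Θ Θ' : Submodule L (σ → L)} (h : Θ ≤ Θ') : dotAnn Θ' ≤ dotAnn Θ :=
  fun _ hu θ hθ => hu θ (h hθ)

/-- `Θ ≤ Θ^⊥⊥`. [folklore] -/
theorem le_dotAnn_dotAnn (Θ : Submodule L (σ → L)) : Θ ≤ dotAnn (dotAnn Θ) := by
  intro θ hθ u hu
  rw [show ∑ i, u i * θ i = ∑ i, θ i * u i from Finset.sum_congr rfl fun i _ => mul_comm _ _]
  exact hu θ hθ

/-- `dim Θ^⊥ = |σ| - dim Θ`. [folklore] -/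
theorem finrank_dotAnn (Θ : Submodule L (σ → L)) :
    Module.finrank L (dotAnn Θ) = Fintype.card σ - Module.finrank L Θ := by
  have := finrank_dotAnn_add Θ; omega

/-- **Double annihilator**: `Θ^⊥⊥ = Θ`. [folklore] -/
theorem dotAnn_dotAnn (Θ : Submodule L (σ → L)) : dotAnn (dotAnn Θ) = Θ := by
  refine (Submodule.eq_of_le_of_finrank_eq (le_dotAnn_dotAnn Θ) ?_).symm
  have h1 := finrank_dotAnn_add Θ
  have h2 := finrank_dotAnn_add (dotAnn Θ)
  omega

omit [Fintype σ] in
/-- Coordinate restrictions of `K`-rational subspaces are `K`-rational. [folklore] -/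
theorem IsKRational.map_funLeft {τ : Type*} (f : τ → σ) {W : Submodule L (σ → L)} (h : IsKRational K W) :
    IsKRational K (W.map (LinearMap.funLeft L L f)) := by
  obtain ⟨s, rfl⟩ := h
  refine ⟨(fun v => v ∘ f) '' s, ?_⟩
  rw [Submodule.map_span, Set.image_image, Set.image_image]
  rfl

/-- **Rank–nullity along a subspace**: `dim(P ∩ f⁻¹X) = dim(P ∩ ker f) + dim(f(P) ∩ X)`.
[folklore] -/
theorem finrank_inf_comap {V V' : Type*} [AddCommGroup V] [Module L V] [AddCommGroup V'] [Module L V']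
    [FiniteDimensional L V] (f : V →ₗ[L] V') (P : Submodule L V) (X : Submodule L V') :
    Module.finrank L ↥(P ⊓ X.comap f) = Module.finrank L ↥(P ⊓ LinearMap.ker f) +
      Module.finrank L ↥(P.map f ⊓ X) := by
  set Q := P ⊓ X.comap f with hQ
  have hrn := LinearMap.finrank_range_add_finrank_ker (f.domRestrict Q)
  have hker : Module.finrank L (LinearMap.ker (f.domRestrict Q)) = Module.finrank L ↥(P ⊓ LinearMap.ker f) := by
    let e : LinearMap.ker (f.domRestrict Q) ≃ₗ[L] ↥(P ⊓ LinearMap.ker f) :=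
      { toFun := fun x => ⟨(x.1 : V), ⟨x.1.2.1, by
            have h := LinearMap.mem_ker.mp x.2
            rw [LinearMap.domRestrict_apply] at h
            exact LinearMap.mem_ker.mpr h⟩⟩
        map_add' := fun _ _ => rfl
        map_smul' := fun _ _ => rfl
        invFun := fun y => ⟨⟨y.1, ⟨y.2.1, by
            show f y.1 ∈ X
            rw [LinearMap.mem_ker.mp y.2.2]; exact X.zero_mem⟩⟩,
            LinearMap.mem_ker.mpr (by rw [LinearMap.domRestrict_apply]; exact LinearMap.mem_ker.mp y.2.2)⟩
        left_inv := fun _ => rfl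
        right_inv := fun _ => rfl }
    exact e.finrank_eq
  have hAB : LinearMap.range (f.domRestrict Q) = P.map f ⊓ X := by
    ext y
    simp only [LinearMap.mem_range, LinearMap.domRestrict_apply, Submodule.mem_inf, Submodule.mem_map]
    constructor
    · rintro ⟨⟨x, hxP, hxX⟩, rfl⟩
      exact ⟨⟨x, hxP, rfl⟩, hxX⟩
    · rintro ⟨⟨x, hxP, rfl⟩, hxX⟩
      exact ⟨⟨x, hxP, hxX⟩, rfl⟩
  have hran : Module.finrank L (LinearMap.range (f.domRestrict Q)) = Module.finrank L ↥(P.map f ⊓ X) := by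
    rw [hAB]
  omega

/-- **The rational replacement.** Let `Z ≤ Θ` with `Z` `K`-rational, and `U` `K`-rational. Then
there is a `K`-rational `Θ'` with `Z ≤ Θ'`, `dim Θ' = dim Θ` and `dim(U ∩ Θ) ≤ dim(U ∩ Θ')`.
[folklore] -/
theorem exists_rational_replacement {Z Θ U : Submodule L (σ → L)} (hZ : IsKRational K Z)
    (hU : IsKRational K U) (hZΘ : Z ≤ Θ) :
    ∃ Θ' : Submodule L (σ → L), IsKRational K Θ' ∧ Z ≤ Θ' ∧
      Module.finrank L Θ' = Module.finrank L Θ ∧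
      Module.finrank L ↥(U ⊓ Θ) ≤ Module.finrank L ↥(U ⊓ Θ') := by
  set a := Module.finrank L ↥(U ⊓ Θ) with ha
  -- Step 1: `U₁` rational with `Z ⊓ U ≤ U₁ ≤ U`, `dim U₁ = a`
  have hZU : IsKRational K (Z ⊓ U) := hZ.inf K hU
  have h1 : Module.finrank L ↥(Z ⊓ U) ≤ a :=
    Submodule.finrank_mono (inf_le_inf_right U hZΘ |>.trans_eq (inf_comm Θ U))
  have h2 : a ≤ Module.finrank L U := Submodule.finrank_mono inf_le_left
  obtain ⟨U₁, hU₁rat, hZU₁, hU₁U, hU₁⟩ := hZU.exists_le_le_finrank_eq K hU inf_le_right h1 h2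
  -- Step 2: `Θ'' = Z ⊔ U₁`, `dim Θ'' ≤ dim Θ`
  have hZU₁eq : Z ⊓ U₁ = Z ⊓ U :=
    le_antisymm (inf_le_inf_left Z hU₁U) (le_inf inf_le_left hZU₁)
  have hdim'' : Module.finrank L ↥(Z ⊔ U₁) ≤ Module.finrank L Θ := by
    have e1 := Submodule.finrank_sup_add_finrank_inf_eq Z U₁
    have e2 := Submodule.finrank_sup_add_finrank_inf_eq Z (Θ ⊓ U)
    rw [hZU₁eq] at e1
    have e3 : Z ⊓ (Θ ⊓ U) = Z ⊓ U := by
      rw [← inf_assoc, inf_eq_left.mpr hZΘ]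
    rw [e3] at e2
    have e4 : Module.finrank L ↥(Z ⊔ Θ ⊓ U) ≤ Module.finrank L Θ :=
      Submodule.finrank_mono (sup_le hZΘ inf_le_left)
    have e5 : Module.finrank L ↥(Θ ⊓ U) = a := by rw [ha, inf_comm]
    omega
  -- Step 3: extend to dimension `dim Θ`
  have hrat'' : IsKRational K (Z ⊔ U₁) := hZ.sup hU₁rat
  have htop : Module.finrank L Θ ≤ Module.finrank L (⊤ : Submodule L (σ → L)) := Submodule.finrank_mono le_top
  obtain ⟨Θ', hΘ'rat, hle', -, hdim'⟩ := hrat''.exists_le_le_finrank_eq K (isKRational_top K) le_top hdim'' htop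
  refine ⟨Θ', hΘ'rat, le_sup_left.trans hle', hdim', ?_⟩
  calc a = Module.finrank L U₁ := hU₁.symm
    _ ≤ Module.finrank L ↥(U ⊓ Θ') := Submodule.finrank_mono (le_inf hU₁U (le_sup_right.trans hle'))

end LiePresentation

/-! ### The index descent on `M_κ` -/

namespace GaGmE

namespace Std

open LiePresentation

variable {β γ δ : Type} [Fintype β] [Fintype γ] [Fintype δ] {κM : δ → γ → Kbar}

/-- The projection `w ↦ (w(s_e))_e` onto the vector-group coordinates. [folklore] -/
def πs : (β ⊕ (γ ⊕ δ) → ℂ) →ₗ[ℂ] (δ → ℂ) := LinearMap.funLeft ℂ ℂ is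

omit [Fintype β] [Fintype γ] [Fintype δ] in
/-- `πs w e = w (is e)`. [folklore] -/
@[simp] theorem πs_apply (w : β ⊕ (γ ⊕ δ) → ℂ) (e : δ) : πs w e = w (is e) := rfl

/-- The Lie algebra cut out by the torus and abelian data only: `Lie(A, C, 0)`. [folklore] -/
def T₀ (A : Submodule ℚ (β → ℚ)) (C : Submodule ℚ (γ → ℚ)) : Submodule ℂ (β ⊕ (γ ⊕ δ) → ℂ) :=
  solSpace Kbar ((yForm (γ := γ) (δ := δ) '' (A : Set (β → ℚ))) ∪ (zForm (β := β) (δ := δ) '' (C : Set (γ → ℚ))))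

/-- Membership in `T₀`. [folklore] -/
theorem mem_T₀ {A : Submodule ℚ (β → ℚ)} {C : Submodule ℚ (γ → ℚ)} {w : β ⊕ (γ ⊕ δ) → ℂ} :
    w ∈ T₀ (δ := δ) A C ↔ (∀ q ∈ A, ∑ j, (q j : ℂ) * w (iy j) = 0) ∧ ∀ c ∈ C, ∑ b, (c b : ℂ) * w (iz b) = 0 := by
  simp only [T₀, mem_solSpace, Set.mem_union, Set.mem_image]
  constructor
  · intro h
    exact ⟨fun q hq => by rw [← pair_yForm]; exact h _ (Or.inl ⟨q, hq, rfl⟩),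
      fun c hc => by rw [← pair_zForm]; exact h _ (Or.inr ⟨c, hc, rfl⟩)⟩
  · rintro ⟨hA, hC⟩ φ (⟨q, hq, rfl⟩ | ⟨c, hc, rfl⟩)
    · rw [pair_yForm]; exact hA q hq
    · rw [pair_zForm]; exact hC c hc

/-- `T₀` is `ℚ̄`-rational. [folklore] -/
theorem isKRational_T₀ (A : Submodule ℚ (β → ℚ)) (C : Submodule ℚ (γ → ℚ)) :
    IsKRational Kbar (T₀ (δ := δ) A C) :=
  isKRational_solSpace Kbar _

/-- `πs` maps `T₀` onto everything. [folklore] -/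
theorem map_πs_T₀ (A : Submodule ℚ (β → ℚ)) (C : Submodule ℚ (γ → ℚ)) :
    (T₀ (δ := δ) A C).map πs = ⊤ := by
  refine eq_top_iff.mpr fun u _ => ?_
  refine ⟨coords (fun _ => 0) (fun _ => 0) u, ?_, ?_⟩
  · rw [SetLike.mem_coe, mem_T₀]
    constructor <;> intros <;> simp
  · funext e; simp

/-- **`Lie(A, C, Ξ) = T₀ ∩ πs⁻¹(Ξ^⊥)`** for `ℂ`-data. [folklore] -/
theorem SubgroupDataC.tangent_eq (K : SubgroupDataC β γ δ κM) :
    K.tangent = T₀ K.A K.C ⊓ (dotAnn K.Ξ).comap πs := by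
  ext w
  rw [SubgroupDataC.mem_tangent_iff, Submodule.mem_inf, mem_T₀, Submodule.mem_comap, mem_dotAnn]
  simp only [πs_apply]
  tauto

/-- **`Lie(A, C, Ξ) = T₀ ∩ πs⁻¹((span_ℂ Ξ)^⊥)`** for `ℚ̄`-data. [folklore] -/
theorem SubgroupData.tangent_eq (D : SubgroupData β γ δ κM) :
    D.tangent = T₀ D.A D.C ⊓ (dotAnn (span ℂ (ofK Kbar '' (D.Ξ : Set (δ → Kbar))))).comap πs := by
  ext w
  rw [SubgroupData.mem_tangent_iff, Submodule.mem_inf, mem_T₀, Submodule.mem_comap, mem_dotAnn]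
  have key : (∀ ξ ∈ D.Ξ, ∑ e, (ξ e : ℂ) * w (is e) = 0) ↔
      ∀ θ ∈ span ℂ (ofK Kbar '' (D.Ξ : Set (δ → Kbar))), ∑ e, θ e * πs w e = 0 := by
    constructor
    · intro h θ hθ
      refine Submodule.span_induction ?_ ?_ ?_ ?_ hθ
      · rintro _ ⟨ξ, hξ, rfl⟩
        simpa [ofK] using h ξ hξ
      · simp
      · intro x y _ _ hx hy
        simp only [Pi.add_apply, add_mul, Finset.sum_add_distrib, hx, hy, add_zero]
      · intro a x _ hx
        simp only [Pi.smul_apply, smul_eq_mul, mul_assoc, ← Finset.mul_sum, hx, mul_zero]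
    · intro h ξ hξ
      have := h (ofK Kbar ξ) (subset_span ⟨ξ, hξ, rfl⟩)
      simpa [ofK] using this
  rw [key]
  tauto

/-- Dimension of `T₀ ∩ πs⁻¹(X)`: `= dim(T₀ ∩ ker πs) + dim X`. [folklore] -/
theorem finrank_T₀_inf_comap (A : Submodule ℚ (β → ℚ)) (C : Submodule ℚ (γ → ℚ)) (X : Submodule ℂ (δ → ℂ)) :
    Module.finrank ℂ ↥(T₀ (δ := δ) A C ⊓ X.comap πs) =
      Module.finrank ℂ ↥(T₀ (δ := δ) A C ⊓ LinearMap.ker πs) + Module.finrank ℂ X := by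
  rw [finrank_inf_comap πs (T₀ A C) X, map_πs_T₀, top_inf_eq]

/-- The compatibility space `W₀ = {ξ : ξ ∘ κ ∈ span_ℂ C}` of the vector-part data. [folklore] -/
def compatSpace (κM : δ → γ → Kbar) (C : Submodule ℚ (γ → ℚ)) : Submodule ℂ (δ → ℂ) :=
  (span ℂ ((fun c : γ → ℚ => fun b => (c b : ℂ)) '' (C : Set (γ → ℚ)))).comap
    (Matrix.vecMulLinear (Matrix.of fun e b => (κM e b : ℂ)))

omit [Fintype γ] in
/-- Membership in the compatibility space. [folklore] -/
theorem mem_compatSpace {C : Submodule ℚ (γ → ℚ)} {ξ : δ → ℂ} :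
    ξ ∈ compatSpace κM C ↔ (fun b => ∑ e, ξ e * (κM e b : ℂ)) ∈
      span ℂ ((fun c : γ → ℚ => fun b => (c b : ℂ)) '' (C : Set (γ → ℚ))) := by
  have e : Matrix.vecMulLinear (Matrix.of fun e b => (κM e b : ℂ)) ξ = fun b => ∑ e, ξ e * (κM e b : ℂ) := by
    funext b
    simp [Matrix.vecMulLinear, Matrix.vecMul, dotProduct]
  rw [compatSpace, Submodule.mem_comap, e]

omit [Fintype γ] in
/-- The `ℂ`-span of `C` is the `ℂ`-span of `ℚ̄`-vectors. [folklore] -/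
theorem span_C_eq (C : Submodule ℚ (γ → ℚ)) :
    span ℂ ((fun c : γ → ℚ => fun b => (c b : ℂ)) '' (C : Set (γ → ℚ))) =
      span ℂ (ofK Kbar (L := ℂ) '' ((fun c : γ → ℚ => fun b => (c b : Kbar)) '' (C : Set (γ → ℚ)))) := by
  rw [Set.image_image]
  congr 1

/-- **The compatibility space is `ℚ̄`-rational.** It is the solution space of the `ℚ̄`-forms
`ξ ↦ ∑_e ξ_e (∑_b θ_b κ_{eb})`, `θ` a `ℚ̄`-point of `(span C)^⊥`. [folklore] -/
theorem isKRational_compatSpace (C : Submodule ℚ (γ → ℚ)) : IsKRational Kbar (compatSpace κM C) := by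
  set S : Submodule ℂ (γ → ℂ) := span ℂ ((fun c : γ → ℚ => fun b => (c b : ℂ)) '' (C : Set (γ → ℚ))) with hS
  have hSrat : IsKRational Kbar S := by rw [hS, span_C_eq]; exact ⟨_, rfl⟩
  have hArat : IsKRational Kbar (dotAnn S) := hSrat.dotAnn Kbar
  -- the forms
  set R : Set (δ → Kbar) := (fun θ : γ → Kbar => fun e => ∑ b, θ b * κM e b) '' (kPoints Kbar (dotAnn S) : Set (γ → Kbar))
  have e : compatSpace κM C = solSpace Kbar R := by
    ext ξ
    rw [mem_compatSpace, ← hS, show S = dotAnn (dotAnn S) from (dotAnn_dotAnn S).symm, mem_dotAnn,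
      hArat.eq_span_kPoints, mem_solSpace]
    have hc : ∀ x : Kbar, algebraMap Kbar ℂ x = (x : ℂ) := fun x => rfl
    constructor
    · rintro h _ ⟨θ, hθ, rfl⟩
      have h1 := h (ofK Kbar θ) (subset_span ⟨θ, hθ, rfl⟩)
      simp only [pair, ofK_apply, map_sum, map_mul] at h1 ⊢
      simp only [hc] at h1 ⊢
      rw [← h1]
      simp only [Finset.sum_mul, Finset.mul_sum]
      rw [Finset.sum_comm]
      exact Finset.sum_congr rfl fun b _ => Finset.sum_congr rfl fun e' _ => by ring
    · intro h θ hθ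
      refine Submodule.span_induction ?_ ?_ ?_ ?_ hθ
      · rintro _ ⟨θ', hθ', rfl⟩
        have h1 := h _ ⟨θ', hθ', rfl⟩
        simp only [pair, ofK_apply, map_sum, map_mul] at h1 ⊢
        simp only [hc] at h1 ⊢
        rw [← h1]
        simp only [Finset.sum_mul, Finset.mul_sum]
        rw [Finset.sum_comm]
        exact Finset.sum_congr rfl fun e' _ => Finset.sum_congr rfl fun b _ => by ring
      · simp
      · intro x y _ _ hx hy
        simp only [Pi.add_apply, add_mul, Finset.sum_add_distrib, hx, hy, add_zero]
      · intro a x _ hx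
        simp only [Pi.smul_apply, smul_eq_mul, mul_assoc, ← Finset.mul_sum, hx, mul_zero]
  rw [e]
  exact isKRational_solSpace Kbar R

variable (κM) in
/-- **Index descent.** For a `ℚ̄`-rational `𝔟 ⊆ Lie M_κ`, semistability (quantified over the
algebraic subgroups with `ℚ̄`-data) implies the index inequality for every subgroup datum over `ℂ`
other than `M_κ` itself: `dim 𝔟 · (n - dim Lie K) ≤ (dim 𝔟 - dim(𝔟 ∩ Lie K)) · n`.
[cite: BakerWustholz2007, §6.7 (index and semistability)] -/
theorem Semistable.index_le {𝔟 : Submodule ℂ (β ⊕ (γ ⊕ δ) → ℂ)} (hss : Semistable κM 𝔟)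
    (hrat : IsKRational Kbar 𝔟) (K : SubgroupDataC β γ δ κM) (hK : K.tangent ≠ ⊤) :
    Module.finrank ℂ 𝔟 * (Fintype.card (β ⊕ (γ ⊕ δ)) - Module.finrank ℂ K.tangent) ≤
      (Module.finrank ℂ 𝔟 - Module.finrank ℂ ↥(𝔟 ⊓ K.tangent)) * Fintype.card (β ⊕ (γ ⊕ δ)) := by
  -- the players
  set Θ : Submodule ℂ (δ → ℂ) := dotAnn K.Ξ with hΘ
  set W₀ : Submodule ℂ (δ → ℂ) := compatSpace κM K.C with hW₀
  set Z : Submodule ℂ (δ → ℂ) := dotAnn W₀ with hZ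
  have hΞW₀ : K.Ξ ≤ W₀ := fun ξ hξ => (mem_compatSpace).mpr (K.compat ξ hξ)
  have hZΘ : Z ≤ Θ := dotAnn_anti hΞW₀
  have hZrat : IsKRational Kbar Z := (isKRational_compatSpace K.C).dotAnn Kbar
  set U : Submodule ℂ (δ → ℂ) := (𝔟 ⊓ T₀ K.A K.C).map πs with hU
  have hUrat : IsKRational Kbar U := (hrat.inf Kbar (isKRational_T₀ K.A K.C)).map_funLeft Kbar is
  obtain ⟨Θ', hΘ'rat, hZΘ', hdimΘ', hdimU⟩ := exists_rational_replacement Kbar hZrat hUrat hZΘ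
  -- the `ℚ̄`-datum
  set Ξ' : Submodule ℂ (δ → ℂ) := dotAnn Θ' with hΞ'
  have hΞ'rat : IsKRational Kbar Ξ' := hΘ'rat.dotAnn Kbar
  have hΞ'W₀ : Ξ' ≤ W₀ := by
    have : dotAnn Θ' ≤ dotAnn Z := dotAnn_anti hZΘ'
    rwa [hZ, dotAnn_dotAnn] at this
  let D : SubgroupData β γ δ κM :=
    { A := K.A
      C := K.C
      Ξ := kPoints Kbar Ξ'
      compat := by
        intro ξ hξ
        have hmem : ofK Kbar ξ ∈ W₀ := hΞ'W₀ hξ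
        rw [hW₀, mem_compatSpace, span_C_eq] at hmem
        have e : (fun b => ∑ e, ofK Kbar (L := ℂ) ξ e * (κM e b : ℂ)) =
            ofK Kbar (fun b => ∑ e, ξ e * κM e b) := by
          funext b; simp [ofK, map_sum, map_mul]
        rw [e] at hmem
        have := (mem_kPoints Kbar).mpr hmem
        rwa [kPoints_span_ofK] at this }
  have hDmem : D.tangent ∈ algLie κM := ⟨D, rfl⟩
  -- the tangent spaces
  have hKt : K.tangent = T₀ K.A K.C ⊓ Θ.comap πs := K.tangent_eq
  have hDt : D.tangent = T₀ K.A K.C ⊓ Θ'.comap πs := by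
    rw [D.tangent_eq]
    show T₀ K.A K.C ⊓ (dotAnn (span ℂ (ofK Kbar '' (kPoints Kbar Ξ' : Set (δ → Kbar))))).comap πs = _
    rw [← hΞ'rat.eq_span_kPoints, hΞ', dotAnn_dotAnn]
  -- dimensions
  have hdimK : Module.finrank ℂ K.tangent = Module.finrank ℂ ↥(T₀ (δ := δ) K.A K.C ⊓ LinearMap.ker πs) +
      Module.finrank ℂ Θ := by rw [hKt, finrank_T₀_inf_comap]
  have hdimD : Module.finrank ℂ D.tangent = Module.finrank ℂ ↥(T₀ (δ := δ) K.A K.C ⊓ LinearMap.ker πs) +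
      Module.finrank ℂ Θ' := by rw [hDt, finrank_T₀_inf_comap]
  have hdimKD : Module.finrank ℂ D.tangent = Module.finrank ℂ K.tangent := by rw [hdimK, hdimD, hdimΘ']
  have hbK : Module.finrank ℂ ↥(𝔟 ⊓ K.tangent) =
      Module.finrank ℂ ↥((𝔟 ⊓ T₀ K.A K.C) ⊓ LinearMap.ker πs) + Module.finrank ℂ ↥(U ⊓ Θ) := by
    rw [hKt, ← inf_assoc, finrank_inf_comap πs (𝔟 ⊓ T₀ K.A K.C) Θ]
  have hbD : Module.finrank ℂ ↥(𝔟 ⊓ D.tangent) =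
      Module.finrank ℂ ↥((𝔟 ⊓ T₀ K.A K.C) ⊓ LinearMap.ker πs) + Module.finrank ℂ ↥(U ⊓ Θ') := by
    rw [hDt, ← inf_assoc, finrank_inf_comap πs (𝔟 ⊓ T₀ K.A K.C) Θ']
  have hbKD : Module.finrank ℂ ↥(𝔟 ⊓ K.tangent) ≤ Module.finrank ℂ ↥(𝔟 ⊓ D.tangent) := by
    rw [hbK, hbD]; exact Nat.add_le_add_left hdimU _
  -- `D.tangent ≠ ⊤`
  have hDtop : D.tangent ≠ ⊤ := by
    intro h
    apply hK
    apply Submodule.eq_top_of_finrank_eq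
    have h1 : Module.finrank ℂ D.tangent = Module.finrank ℂ (β ⊕ (γ ⊕ δ) → ℂ) := by
      rw [h, finrank_top]
    rw [← hdimKD, h1]
  -- semistability for `D`
  have hssD := hss D.tangent hDmem hDtop
  rw [hdimKD] at hssD
  refine hssD.trans (Nat.mul_le_mul_right _ ?_)
  omega

end Std

end GaGmE


end Literature.NumberTheory.Transcendental

end
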